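import Literature.RingTheory.KTheory.MilnorKStiefelWhitney
import Literature.RingTheory.KTheory.MilnorKStarGraded
import HarnessLib

/-!
# The grading of `k_*F = K_*F/2K_*F`: the canonical maps `k_nF → k_*F` are injective and `k_*F = ⊕ₙ k_nF`
# (Milnor, *Algebraic K-theory and quadratic forms*, Invent. Math. 9 (1970), §3)

Family `hodge`, lane `lit-hodgefound` (foundations library; seat `lit-hodgefound-p27`, generation 40, row g40-#15);
topic `RingTheory/KTheory`.  Sequel of `MilnorKStarGraded` (g40-#8: the graded model `GradedModel F ≅ ⊕ₙ K_nF` with the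
`K_*F`-action `grho`, `gproj`, `gcomponent`), `MilnorKModTwo` (g40-#9: `k_nF = MilnorK.Mod2 F n`) and
`MilnorKStiefelWhitney` (g40-#14: the ring `k_*F = Mod2Ring F` with `toMod2 : K_*F → k_*F` and the canonical maps
`kOfDeg F n : k_nF →+ k_*F`).  DEFINITIONS WITH BODIES (the `abbrev GradedModel2`, `gmk2`, `gact2`, `grho2`, `krho`,
`kproj`, `gcomponent2`, `kRange`) and PROVED THEOREMS; no named fact, no instance, no notation, 0 `sorry`, net debt 0
(D-0026).

## The source, verbatim

J. Milnor, *Algebraic K-theory and quadratic forms*, Invent. Math. 9 (1970) 318–344 (held `paper:doi-10-1007-bf01425486`;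
bib key `Milnor1970`), §3 (p0010 L27–L31): «For the rest of this paper we will only be interested in the quotient of
the ring K_*F by the ideal 2K_*F. To simplify the notation, let us set k_nF = K_nF/2K_nF. Thus k_*F is a graded
algebra over Z/2Z, with k₁F ≅ F•/F•².»

## What is formalised

That the quotient RING `k_*F = K_*F/2K_*F` (`Mod2Ring F` of `MilnorKStiefelWhitney`) is graded by the quotient GROUPS
`k_nF = K_nF/2K_nF` (`MilnorK.Mod2 F n` of `MilnorKModTwo`): the graded model of `MilnorKStarGraded` is reduced modulo
`2` (`GradedModel2 F`, on which `2` acts as `0`, `gmk2_add_self`), the action of `K_*F` descends (`gact2`, `grho2`,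
`grho2_two : 2 ↦ 0`) and hence factors through `k_*F` (**`krho : k_*F →+* End(⊕ₙ k_nF)`**, by the universal property
of `RingQuot`); the projection **`kproj : k_*F → ⊕ₙ k_nF`**, `x ↦ x · {}`, and the components
**`gcomponent2 n : ⊕ₘ k_mF → k_nF`** give **`gcomponent2_kproj_kOfDeg : k_nF → k_*F → ⊕ k_mF → k_nF = id`**, whence
**`kOfDeg_injective`** (the canonical maps `k_nF → k_*F` are injective), **`iSupIndep_kRange`** (the images
`kRange F n` are independent) and **`iSup_kRange : ⨆ₙ kRange F n = ⊤`** — `k_*F = ⊕ₙ k_nF` as printed.  (The images are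
named `kRange F n` because forming `(kOfDeg F n).range` under a binder meets the instance-synthesis limitation recorded
in `MilnorKStarGraded`.)

## References

* [Milnor1970] J. Milnor, *Algebraic K-theory and quadratic forms*, Invent. Math. 9 (1970) 318–344 — §3, the graded
  algebra `k_*F` (p0010 L27–L31).

Provenance: lane `lit-hodgefound`, seat `lit-hodgefound-p27` gen 40 (agent `literature-prover-lit-hodgefound-p27-g40-0`),
row g40-#15.
-/

set_option autoImplicit false

noncomputable section

namespace Literature.RingTheory.KTheory

open Function

/-! ### the grading of `k_*F`: `k_*F = ⊕ₙ k_nF` -/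

section GradedModTwo

variable (F : Type*) [Field F]

namespace MilnorKStar

/-- **The graded model modulo `2`: `⊕ₙ k_nF = (⊕ₙ K_nF) / 2`** (a quotient group of `GradedModel F`; an `abbrev`, no
instance declared). [cite: Milnor1970, §3 «k_nF = K_nF/2K_nF. Thus k_*F is a graded algebra over Z/2Z» (p0010 L27–L31)] -/
abbrev GradedModel2 : Type _ := GradedModel F ⧸ (zsmulAddGroupHom (α := GradedModel F) 2).range

/-- The projection `⊕ₙ K_nF → ⊕ₙ k_nF`. [cite: Milnor1970, §3, the graded algebra k_*F (p0010 L27–L31)] -/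
def gmk2 : GradedModel F →+ GradedModel2 F := QuotientAddGroup.mk' _

/-- `⊕ₙ K_nF → ⊕ₙ k_nF` is onto. [cite: Milnor1970, §3, the graded algebra k_*F (p0010 L27–L31)] -/
theorem gmk2_surjective : Function.Surjective (gmk2 F) := QuotientAddGroup.mk'_surjective _

/-- `2m ↦ 0`. [cite: Milnor1970, §3, the graded algebra k_*F (p0010 L27–L31)] -/
theorem gmk2_two_zsmul (m : GradedModel F) : gmk2 F ((2 : ℤ) • m) = 0 :=
  (QuotientAddGroup.eq_zero_iff _).2 ⟨m, rfl⟩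

/-- `⊕ₙ k_nF` is an `𝔽₂`-vector space: `v + v = 0`. [cite: Milnor1970, §3 «k_nF = K_nF/2K_nF. Thus k_*F is a graded algebra over Z/2Z» (p0010 L27–L31)] -/
theorem gmk2_add_self (v : GradedModel2 F) : v + v = 0 := by
  obtain ⟨m, rfl⟩ := gmk2_surjective F v
  rw [← map_add, ← two_zsmul]; exact gmk2_two_zsmul F m

/-- The action of `x ∈ K_*F` on `⊕ₙ K_nF` descends modulo `2`. [cite: Milnor1970, §3, the graded algebra k_*F (p0010 L27–L31)] -/
def gact2 (x : MilnorKStar F) : GradedModel2 F →+ GradedModel2 F :=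
  QuotientAddGroup.map _ _ ((grho F x : AddMonoid.End (GradedModel F)) : GradedModel F →+ GradedModel F) (by
    rintro m ⟨m', rfl⟩
    rw [AddSubgroup.mem_comap, zsmulAddGroupHom_apply]
    exact ⟨grho F x m', by rw [zsmulAddGroupHom_apply]; exact (map_zsmul _ _ _).symm⟩)

/-- `gact2 x` on classes. [cite: Milnor1970, §3, the graded algebra k_*F (p0010 L27–L31)] -/
theorem gact2_gmk2 (x : MilnorKStar F) (m : GradedModel F) : gact2 F x (gmk2 F m) = gmk2 F (grho F x m) := rfl

/-- **`K_*F` acts on `⊕ₙ k_nF`**: the ring homomorphism `K_*F → End(⊕ₙ k_nF)`. [cite: Milnor1970, §3, the graded algebra k_*F (p0010 L27–L31)] -/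
def grho2 : MilnorKStar F →+* AddMonoid.End (GradedModel2 F) where
  toFun x := gact2 F x
  map_one' := QuotientAddGroup.addMonoidHom_ext _ (AddMonoidHom.ext fun m => by
    change gact2 F 1 (gmk2 F m) = gmk2 F m
    rw [gact2_gmk2, map_one]; rfl)
  map_mul' x y := QuotientAddGroup.addMonoidHom_ext _ (AddMonoidHom.ext fun m => by
    change gact2 F (x * y) (gmk2 F m) = gact2 F x (gact2 F y (gmk2 F m))
    rw [gact2_gmk2, gact2_gmk2, gact2_gmk2, map_mul]; rfl)
  map_zero' := QuotientAddGroup.addMonoidHom_ext _ (AddMonoidHom.ext fun m => by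
    change gact2 F 0 (gmk2 F m) = 0
    rw [gact2_gmk2, map_zero]; rfl)
  map_add' x y := QuotientAddGroup.addMonoidHom_ext _ (AddMonoidHom.ext fun m => by
    change gact2 F (x + y) (gmk2 F m) = gact2 F x (gmk2 F m) + gact2 F y (gmk2 F m)
    rw [gact2_gmk2, gact2_gmk2, gact2_gmk2, map_add]
    change gmk2 F (grho F x m + grho F y m) = _
    rw [map_add])

/-- `grho2 x` on classes is the class of `grho x`. [cite: Milnor1970, §3, the graded algebra k_*F (p0010 L27–L31)] -/
theorem grho2_apply_gmk2 (x : MilnorKStar F) (m : GradedModel F) : grho2 F x (gmk2 F m) = gmk2 F (grho F x m) := rfl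

/-- **`2 ∈ K_*F` acts as `0` on `⊕ₙ k_nF`.** [cite: Milnor1970, §3 «k_nF = K_nF/2K_nF. Thus k_*F is a graded algebra over Z/2Z» (p0010 L27–L31)] -/
theorem grho2_two : grho2 F 2 = 0 := by
  refine QuotientAddGroup.addMonoidHom_ext _ (AddMonoidHom.ext fun m => ?_)
  change grho2 F 2 (gmk2 F m) = 0
  rw [grho2_apply_gmk2, show (2 : MilnorKStar F) = 1 + 1 from one_add_one_eq_two.symm, map_add, map_one]
  change gmk2 F (m + m) = 0
  rw [map_add]
  exact gmk2_add_self F _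

/-- `toMod2` is `RingQuot.mkRingHom`. [cite: Milnor1970, §3, the graded algebra k_*F (p0010 L27–L31)] -/
theorem toMod2_eq_mkRingHom (x : MilnorKStar F) : toMod2 F x = RingQuot.mkRingHom (twoRel F) x := by
  rw [toMod2, ← RingQuot.mkAlgHom_coe ℤ (twoRel F)]; rfl

/-- **`k_*F = K_*F/2K_*F` acts on `⊕ₙ k_nF`**: the action of `K_*F` factors through the quotient by `2` (universal property
of `RingQuot`). [cite: Milnor1970, §3 «k_nF = K_nF/2K_nF. Thus k_*F is a graded algebra over Z/2Z» (p0010 L27–L31)] -/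
def krho : Mod2Ring F →+* AddMonoid.End (GradedModel2 F) :=
  RingQuot.lift ⟨grho2 F, by rintro x y ⟨rfl, rfl⟩; rw [grho2_two, map_zero]⟩

/-- `krho` on classes is `grho2`. [cite: Milnor1970, §3, the graded algebra k_*F (p0010 L27–L31)] -/
theorem krho_toMod2 (x : MilnorKStar F) : krho F (toMod2 F x) = grho2 F x := by
  rw [toMod2_eq_mkRingHom, krho, RingQuot.lift_mkRingHom_apply]

/-- **The projection `k_*F → ⊕ₙ k_nF`**, `x ↦ x · {}`. [cite: Milnor1970, §3, the graded algebra k_*F (p0010 L27–L31)] -/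
def kproj : Mod2Ring F →+ GradedModel2 F where
  toFun x := krho F x (gmk2 F (gsymbol F 0 Fin.elim0))
  map_zero' := by rw [map_zero]; rfl
  map_add' x y := by rw [map_add]; rfl

/-- `kproj (l(c₁)⋯l(cₙ)) = {c₁, …, cₙ}` in degree `n`. [cite: Milnor1970, §3, the graded algebra k_*F (p0010 L27–L31)] -/
theorem kproj_kOfDeg_kSymbol {n : ℕ} (c : Fin n → Fˣ) :
    kproj F (kOfDeg F n (MilnorK.kSymbol c)) = gmk2 F (gsymbol F n c) := by
  change krho F (kOfDeg F n (MilnorK.kSymbol c)) (gmk2 F (gsymbol F 0 Fin.elim0)) = _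
  rw [MilnorK.kSymbol_def, kOfDeg_kmk, krho_toMod2, grho2_apply_gmk2, ← gproj_apply, gproj_ofDeg_symbol]

/-- **The degree-`n` component `⊕ₘ k_mF → k_nF`** (the component `gcomponent` of `MilnorKStarGraded` modulo `2`). [cite: Milnor1970, §3, the graded algebra k_*F (p0010 L27–L31)] -/
def gcomponent2 (n : ℕ) : GradedModel2 F →+ MilnorK.Mod2 F n :=
  QuotientAddGroup.map _ _ (gcomponent F n) (by
    rintro m ⟨m', rfl⟩
    rw [AddSubgroup.mem_comap, zsmulAddGroupHom_apply, map_zsmul]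
    exact MilnorK.two_zsmul_mem_twoMultiples F n _)

/-- `gcomponent2` on classes. [cite: Milnor1970, §3, the graded algebra k_*F (p0010 L27–L31)] -/
theorem gcomponent2_gmk2 (n : ℕ) (m : GradedModel F) :
    gcomponent2 F n (gmk2 F m) = MilnorK.kmk F n (gcomponent F n m) := rfl

/-- **`k_nF → k_*F → ⊕ₘ k_mF → k_nF` is the identity.** [cite: Milnor1970, §3 «k_nF = K_nF/2K_nF. Thus k_*F is a graded algebra over Z/2Z» (p0010 L27–L31)] -/
theorem gcomponent2_kproj_kOfDeg {n : ℕ} (x : MilnorK.Mod2 F n) : gcomponent2 F n (kproj F (kOfDeg F n x)) = x := by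
  suffices h : ((gcomponent2 F n).comp ((kproj F).comp (kOfDeg F n))) = AddMonoidHom.id _ from DFunLike.congr_fun h x
  refine MilnorK.mod2_hom_ext (fun c => ?_)
  rw [AddMonoidHom.comp_apply, AddMonoidHom.comp_apply, ← MilnorK.kSymbol_def, kproj_kOfDeg_kSymbol, gcomponent2_gmk2,
    gcomponent_gsymbol_self, AddMonoidHom.id_apply, MilnorK.kSymbol_def]

/-- `k_mF → k_*F → ⊕ k → k_nF` vanishes for `m ≠ n`. [cite: Milnor1970, §3, the graded algebra k_*F (p0010 L27–L31)] -/
theorem gcomponent2_kproj_kOfDeg_of_ne {m n : ℕ} (h : m ≠ n) (x : MilnorK.Mod2 F m) :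
    gcomponent2 F n (kproj F (kOfDeg F m x)) = 0 := by
  suffices h : ((gcomponent2 F n).comp ((kproj F).comp (kOfDeg F m))) = 0 from DFunLike.congr_fun h x
  refine MilnorK.mod2_hom_ext (fun c => ?_)
  rw [AddMonoidHom.comp_apply, AddMonoidHom.comp_apply, ← MilnorK.kSymbol_def, kproj_kOfDeg_kSymbol, gcomponent2_gmk2,
    gcomponent_gsymbol_of_ne F h, map_zero, AddMonoidHom.zero_apply]

/-- **The canonical maps `k_nF → k_*F` are injective**: `k_nF = K_nF/2K_nF` is the degree-`n` part of the ring
`k_*F = K_*F/2K_*F`. [cite: Milnor1970, §3 «k_nF = K_nF/2K_nF. Thus k_*F is a graded algebra over Z/2Z» (p0010 L27–L31)] -/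
theorem kOfDeg_injective (n : ℕ) : Function.Injective (kOfDeg F n) := fun x y h => by
  rw [← gcomponent2_kproj_kOfDeg F x, h, gcomponent2_kproj_kOfDeg]

/-- The image of `k_nF` in `k_*F`, the degree-`n` part (named, so that it can be used under binders). [cite: Milnor1970, §3, the graded algebra k_*F (p0010 L27–L31)] -/
def kRange (n : ℕ) : AddSubgroup (Mod2Ring F) := (kOfDeg F n).range

/-- Membership in `kRange`. [cite: Milnor1970, §3, the graded algebra k_*F (p0010 L27–L31)] -/
theorem mem_kRange_iff {n : ℕ} (y : Mod2Ring F) : y ∈ kRange F n ↔ ∃ x, kOfDeg F n x = y := Iff.rfl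

/-- **The degree-`n` parts of `k_*F` are independent.** [cite: Milnor1970, §3 «k_nF = K_nF/2K_nF. Thus k_*F is a graded algebra over Z/2Z» (p0010 L27–L31)] -/
theorem iSupIndep_kRange : iSupIndep (kRange F) := by
  intro n
  rw [disjoint_iff_inf_le]
  rintro y ⟨⟨x, rfl⟩, hy⟩
  have hQ : ∀ z ∈ ⨆ m, ⨆ (_ : m ≠ n), kRange F m, kOfDeg F n (gcomponent2 F n (kproj F z)) = 0 := by
    intro z hz
    refine AddSubgroup.iSup_induction (C := fun z => kOfDeg F n (gcomponent2 F n (kproj F z)) = 0) _ hz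
      (fun m z hz => ?_) (by rw [map_zero, map_zero, map_zero])
      (fun a b ha hb => by rw [map_add, map_add, map_add, ha, hb, add_zero])
    refine AddSubgroup.iSup_induction (C := fun z => kOfDeg F n (gcomponent2 F n (kproj F z)) = 0) _ hz
      (fun hm w hw => ?_) (by rw [map_zero, map_zero, map_zero])
      (fun a b ha hb => by rw [map_add, map_add, map_add, ha, hb, add_zero])
    obtain ⟨v, rfl⟩ := hw
    rw [gcomponent2_kproj_kOfDeg_of_ne F hm, map_zero]
  have := hQ _ hy
  rw [gcomponent2_kproj_kOfDeg] at this
  rw [AddSubgroup.mem_bot]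
  exact this

/-- **`k_*F` is generated by its degree-`n` parts**: with `iSupIndep_kRange` and `kOfDeg_injective`, `k_*F = ⊕ₙ k_nF`
(«k_*F is a graded algebra over Z/2Z»). [cite: Milnor1970, §3 «k_nF = K_nF/2K_nF. Thus k_*F is a graded algebra over Z/2Z» (p0010 L27–L31)] -/
theorem iSup_kRange : (⨆ n : ℕ, kRange F n) = ⊤ := by
  classical
  rw [eq_top_iff]
  rintro x -
  obtain ⟨x, rfl⟩ := toMod2_surjective F x
  have hx : x ∈ (⊤ : AddSubgroup (MilnorKStar F)) := trivial
  rw [← iSup_range_ofDeg] at hx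
  refine AddSubgroup.iSup_induction (C := fun y => toMod2 F y ∈ ⨆ n : ℕ, kRange F n) _ hx (fun n y hy => ?_)
    (by rw [map_zero]; exact zero_mem _) (fun a b ha hb => by rw [map_add]; exact add_mem ha hb)
  obtain ⟨z, rfl⟩ := hy
  exact AddSubgroup.mem_iSup_of_mem n ⟨MilnorK.kmk F n z, kOfDeg_kmk F z⟩

end MilnorKStar

end GradedModTwo

end Literature.RingTheory.KTheory

end
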